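import Summits.AtomisticToContinuum.BoseEinsteinCondensation.Theorems.LatticeODLROOffHalfFilling.Negative.OffHalfFillingPrelim

/-!
# Route `BECGroundStateSOS`, crux `LatticeODLROOffHalfFilling` (stmt-AtomisticToContinuum-11033),
# line `Sketch`: the registered stub `stub_average`

Supports (does not close) stmt-AtomisticToContinuum-11033. Averaging over the columns of the
ground projection `P₀ = A.groundProj`: since `tr(P₀T) = Σ_σ ⟨P₀e_σ, T P₀e_σ⟩`
(`trace_groundProj_mul_eq_sum`) and `tr P₀ = Σ_σ ‖P₀e_σ‖² > 0` (`trace_groundProj_ne_zero`), a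
per-column bound `c‖ψ‖² ≤ Re⟨ψ, Tψ⟩` on the nonzero columns `ψ = P₀e_σ` sums to
`c · tr P₀ ≤ Re tr(P₀T)`, i.e. `c ≤ Re ω_A(T)` for the tracial ground state `ω_A = tr(P₀ ·)/tr P₀`.
This is the "∀ columns ⇒ average" companion of the pigeonhole `exists_col_quad_ge`. All [folklore].
-/

noncomputable section

namespace Summit.AtomisticToContinuum.BoseEinsteinCondensation.Theorems.LatticeODLROOffHalfFilling.Ladder

open Literature.MathematicalPhysics.QuantumLattice Literature.Probability.LatticeModels Matrix Finset
open Summit.AtomisticToContinuum.BoseEinsteinCondensation.Theorems.LatticeODLROOffHalfFilling.Negative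
open scoped ComplexOrder BigOperators

/-- **`tr P₀` as a column sum**: `tr P₀ = Σ_σ ⟨P₀e_σ, P₀e_σ⟩` (the case `T = 1` of
`trace_groundProj_mul_eq_sum`). [folklore] -/
theorem trace_groundProj_eq_sum_col {m : Type*} [Fintype m] [DecidableEq m] (A : Matrix m m ℂ) :
    A.groundProj.trace = ∑ σ, star (A.groundProj.col σ) ⬝ᵥ (A.groundProj.col σ) := by
  have h := trace_groundProj_mul_eq_sum A 1
  rw [mul_one] at h
  simpa only [one_mulVec] using h

/-- **The tracial ground state as a ratio of real column sums**:
`Re ω_A(T) = (Σ_σ Re⟨P₀e_σ, T P₀e_σ⟩) / Σ_σ ‖P₀e_σ‖²`. [folklore] -/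
theorem re_groundStateFunctional_eq_div {m : Type*} [Fintype m] [DecidableEq m]
    (A T : Matrix m m ℂ) :
    (A.groundStateFunctional T).re =
      (∑ σ, (star (A.groundProj.col σ) ⬝ᵥ T *ᵥ A.groundProj.col σ).re) /
        ∑ σ, (star (A.groundProj.col σ) ⬝ᵥ (A.groundProj.col σ)).re := by
  have hreal : (∑ σ, star (A.groundProj.col σ) ⬝ᵥ (A.groundProj.col σ)) =
      (((∑ σ, (star (A.groundProj.col σ) ⬝ᵥ (A.groundProj.col σ)).re) : ℝ) : ℂ) := by
    rw [Complex.ofReal_sum]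
    exact Finset.sum_congr rfl fun σ _ => star_dotProduct_self_eq_ofReal _
  rw [groundStateFunctional_apply, trace_groundProj_mul_eq_sum A T, trace_groundProj_eq_sum_col A,
    hreal, ← Complex.ofReal_inv, Complex.re_ofReal_mul, Complex.re_sum, inv_mul_eq_div]

/-- **`tr P₀ > 0` as a real column sum**: `0 < Σ_σ ‖P₀e_σ‖²` for Hermitian `A` on a nonempty index
type (some column of `P₀` is nonzero because `tr P₀ ≠ 0`). [folklore] -/
theorem sum_re_col_normSq_pos {m : Type*} [Fintype m] [DecidableEq m] [Nonempty m]
    {A : Matrix m m ℂ} (hA : A.IsHermitian) :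
    0 < ∑ σ, (star (A.groundProj.col σ) ⬝ᵥ (A.groundProj.col σ)).re := by
  have hnn : ∀ σ, 0 ≤ (star (A.groundProj.col σ) ⬝ᵥ (A.groundProj.col σ)).re := fun σ =>
    (Complex.nonneg_iff.mp (dotProduct_star_self_nonneg _)).1
  obtain ⟨σ₀, hσ₀⟩ : ∃ σ, A.groundProj.col σ ≠ 0 := by
    by_contra hall
    push Not at hall
    have h0 : A.groundProj.trace = 0 := by
      rw [trace_groundProj_eq_sum_col]
      exact Finset.sum_eq_zero fun σ _ => by simp [hall σ]
    exact (trace_groundProj_ne_zero hA) h0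
  have hpos₀ : 0 < (star (A.groundProj.col σ₀) ⬝ᵥ (A.groundProj.col σ₀)).re := by
    have hne : star (A.groundProj.col σ₀) ⬝ᵥ (A.groundProj.col σ₀) ≠ 0 := fun h0 =>
      hσ₀ (dotProduct_star_self_eq_zero.mp h0)
    have hre := star_dotProduct_self_eq_ofReal (A.groundProj.col σ₀)
    rcases (hnn σ₀).lt_or_eq with hlt | heq
    · exact hlt
    · exfalso
      apply hne
      rw [hre, ← heq]
      simp
  exact Finset.sum_pos' (fun σ _ => hnn σ) ⟨σ₀, Finset.mem_univ _, hpos₀⟩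

/-- **Averaging over the columns of `P₀`.** A lower bound `c‖ψ‖² ≤ Re⟨ψ, Tψ⟩` on every nonzero
column `ψ = P₀e_σ` of the ground projection gives `c ≤ Re ω_A(T)` for the tracial ground state
(`tr(P₀T) = Σ_σ ⟨P₀e_σ, T P₀e_σ⟩`, `tr P₀ = Σ_σ ‖P₀e_σ‖² > 0`). [folklore] -/
theorem stub_average {m : Type*} [Fintype m] [DecidableEq m] [Nonempty m]
    {A : Matrix m m ℂ} (hA : A.IsHermitian) (T : Matrix m m ℂ) (c : ℝ)
    (h : ∀ σ, A.groundProj.col σ ≠ 0 →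
      c * (star (A.groundProj.col σ) ⬝ᵥ A.groundProj.col σ).re ≤
        (star (A.groundProj.col σ) ⬝ᵥ T *ᵥ (A.groundProj.col σ)).re) :
    c ≤ (A.groundStateFunctional T).re := by
  -- every column satisfies the bound: nonzero columns by `h`, zero columns trivially (`0 ≤ 0`)
  have hle : ∀ σ, c * (star (A.groundProj.col σ) ⬝ᵥ A.groundProj.col σ).re ≤
      (star (A.groundProj.col σ) ⬝ᵥ T *ᵥ (A.groundProj.col σ)).re := by
    intro σ
    by_cases h0 : A.groundProj.col σ = 0
    · simp [h0]
    · exact h σ h0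
  -- sum over the columns and divide by `Σ_σ ‖P₀e_σ‖² > 0`
  have hsum : c * ∑ σ, (star (A.groundProj.col σ) ⬝ᵥ (A.groundProj.col σ)).re ≤
      ∑ σ, (star (A.groundProj.col σ) ⬝ᵥ T *ᵥ (A.groundProj.col σ)).re := by
    rw [Finset.mul_sum]
    exact Finset.sum_le_sum fun σ _ => hle σ
  rw [re_groundStateFunctional_eq_div, le_div_iff₀ (sum_re_col_normSq_pos hA)]
  exact hsum

end Summit.AtomisticToContinuum.BoseEinsteinCondensation.Theorems.LatticeODLROOffHalfFilling.Ladder
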